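import Literature.MathematicalPhysics.QuantumLattice.GrassmannWeightedEffectiveActionTruncation
import Literature.MathematicalPhysics.QuantumLattice.GrassmannWeightedCumulantBoundDB
import Literature.MathematicalPhysics.QuantumLattice.GrassmannEffectiveActionTruncationDB
import HarnessLib

/-!
# Truncating the decay-weighted cumulant expansion for DETERMINANT-BOUNDED covariances
# (twin of `GrassmannWeightedEffectiveActionTruncation` under `IsGramBoundedR`)

Topic `Literature/MathematicalPhysics/QuantumLattice`; continuation of `GrassmannWeightedCumulantBoundDB` (the weighted order-`n` cumulant
bound `sum_wt_norm_kernel_cumulantOf_le_pow_of_gramBounded` for replica-stably Gram-bounded covariances, Pedra–Salmhofer) and of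
`GrassmannEffectiveActionTruncationDB` (the unweighted truncated step under `IsGramBoundedR`).  The refined single-scale step — first cumulant
(the Gaussian convolution `μ_C ⋆ V`) exact, the higher cumulants bounded by `ρ^{-m} e‖V‖_{h,wt} θ/(1-θ)` in the `wt`-WEIGHTED pinned `L¹–L^∞`
norms (Benfatto–Giuliani–Mastropietro 2006, (2.13)–(2.14), (2.77)–(2.80), (2.86)–(2.90), with the decay bookkeeping of §3) — re-run VERBATIM
under `IsGramBoundedR C κ` (the explicit-Gram hypotheses `q, f, g` of the weighted file replaced by the determinant bound; the two inner
estimates are `sum_wt_norm_kernel_cumulantOf_le_pow_of_gramBounded` and `norm_constPart_cumulantOf_le_pow_of_gramBounded`):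

* `sum_wt_norm_kernel_effAction_add_sum_cumulant_le_of_gramBounded`, **`sum_wt_norm_kernel_effAction_sub_gaussConv_le_of_gramBounded`**
  (`Σ_{W : W_i = w} wt(W) ‖kernel_m (effAction C V − e^{Δ_C} V)(W)‖ ≤ ρ^{-m} · e‖V‖_{h,wt} · θ/(1−θ)`, `θ = eα‖V‖_{h,wt}/κ²`),
  `sum_wt_norm_kernel_effAction_sub_secondOrder_le_of_gramBounded`.

Used by the scale-`0` two-leg exports of the K3 engine of the cell gate-hubbard-kl (the two-leg kernel of the step is the degree where the
bi-graded bound `GrassmannWeightedEffectiveActionBiGradedDB` gives no coupling gain; the truncation supplies the one power of `θ`).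

Everything is proved; no definition, no named fact.

## Sources

G. Benfatto, A. Giuliani, V. Mastropietro, Ann. Henri Poincaré 7 (2006) 809–898, (2.13)–(2.14), (2.77)–(2.80), (2.86)–(2.90), §3 (3.2)–(3.8)
[`BenfattoGiulianiMastropietro2006`]; W. de Siqueira Pedra, M. Salmhofer, Comm. Math. Phys. 282 (2008) 797–818, Thm 2.4
[`PedraSalmhofer2008`]; K. Gawȩdzki, A. Kupiainen, Comm. Math. Phys. 102 (1985) 1–30, §3 [`GawedzkiKupiainen1985GrossNeveu`].
-/

noncomputable section

namespace Literature.MathematicalPhysics.QuantumLattice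

open GrassmannAlgebra Finset Literature.Probability.LatticeModels Literature.Probability.LatticeModels.BattleFederbush
open scoped InnerProductSpace Nat

universe u

variable {𝕜 : Type*} [RCLike 𝕜] {Γ : Type u} [Fintype Γ] [DecidableEq Γ] (C : Matrix Γ Γ 𝕜) {wt : Finset Γ → ℝ}

/-- (Twin of `sum_wt_norm_kernel_effAction_add_sum_cumulant_le` under `IsGramBoundedR`.) **Truncated decay-weighted cumulant expansion of the effective action with a geometric remainder** (Benfatto–
Giuliani–Mastropietro 2006, (2.13)–(2.14) with (2.77)–(2.80) and §3): for a tree weight `wt`, with `θ = eα‖V‖_h/κ² < 1`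
(weighted norms), for every `n₀ ≥ 1` and every degree `m ≥ 1`, one output label pinned and the output label set weighted,
`Σ_{W : W_i = w} wt(W) ‖kernel_m (effAction C V + Σ_{1 ≤ n < n₀} (n!)⁻¹ 𝓔ᵀ_C(-V; n)) (W)‖ ≤ ρ^{-m} e‖V‖_h θ^{n₀-1}/(1 - θ)`.
[cite: BenfattoGiulianiMastropietro2006, (2.13)-(2.14), (2.77)-(2.80) and §3 (3.2)-(3.8)] -/
theorem sum_wt_norm_kernel_effAction_add_sum_cumulant_le_of_gramBounded (hwt : IsTreeWeight wt) {κ : ℝ} (hκ : 0 < κ)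
    (hGB : IsGramBoundedR C κ)
    (V : GrassmannAlgebra 𝕜 Γ) (hV : V ∈ evenPart 𝕜 Γ) (hV0 : constPart 𝕜 V = 0) (N : ℕ → ℝ) (hN0 : ∀ m', 0 ≤ N m')
    (hN : ∀ m' (j : Fin (2 * m')) (w : Γ), ∑ Y ∈ univ.filter (fun Y : Fin (2 * m') → Γ => Y j = w),
      ‖kernel 𝕜 V (2 * m') Y‖ * wt (univ.image Y) ≤ N m')
    {α : ℝ} (hα : 0 < α) (hrow : ∀ X, ∑ Y, ‖C X Y‖ * wt {X, Y} ≤ α) (hcol : ∀ Y, ∑ X, ‖C X Y‖ * wt {X, Y} ≤ α) {ρ : ℝ} (hρ : 0 < ρ)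
    (hθ : Real.exp 1 * α * normV Γ κ ρ N / κ ^ 2 < 1) {n₀ : ℕ} (hn₀ : 0 < n₀) :
    IsUnit (effPartitionFn 𝕜 C V) ∧ ∀ {m : ℕ}, 0 < m → ∀ (i : Fin m) (w : Γ),
      ∑ W ∈ univ.filter (fun W : Fin m → Γ => W i = w), wt (univ.image W) *
        ‖kernel 𝕜 (effAction 𝕜 C V) m W + ∑ n ∈ Ico 1 n₀, ((n ! : 𝕜))⁻¹ *
          kernel 𝕜 ((cumulantOf (fun k => evenGaussConv 𝕜 C ((⟨-V, neg_mem hV⟩ : evenPart 𝕜 Γ) ^ k)) n :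
            evenPart 𝕜 Γ) : GrassmannAlgebra 𝕜 Γ) m W‖ ≤
        ρ⁻¹ ^ m * (Real.exp 1 * normV Γ κ ρ N) *
          (Real.exp 1 * α * normV Γ κ ρ N / κ ^ 2) ^ (n₀ - 1) / (1 - Real.exp 1 * α * normV Γ κ ρ N / κ ^ 2) := by
  -- notation
  set X : evenPart 𝕜 Γ := ⟨-V, neg_mem hV⟩ with hX
  set degs : Finset ℕ := range (Fintype.card Γ / 2 + 1) with hdegs
  set K : (m' : ℕ) → (Fin (2 * m') → Γ) → 𝕜 := fun m' => kernel 𝕜 (-V) (2 * m') with hK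
  set nV : ℝ := normV Γ κ ρ N with hnV
  set θ : ℝ := Real.exp 1 * α * nV / κ ^ 2 with hθdef
  have hnV0 : 0 ≤ nV := normV_nonneg hκ.le hρ.le hN0
  have hθ0 : 0 ≤ θ := by positivity
  have hθ1 : θ < 1 := hθ
  have hnVsum : ∑ m' ∈ degs, (Real.exp 2 * (κ + ρ)) ^ (2 * m') * N m' = nV := rfl
  have hexpn : ∀ k : ℕ, Real.exp k = Real.exp 1 ^ k := fun k => by rw [← Real.exp_nat_mul, mul_one]
  -- `-V` as the `vertexOf` of its kernels
  have hXv : vertexOf 𝕜 degs K = X := Subtype.ext (coe_vertexOf_kernel_eq 𝕜 X)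
  have hKnorm : ∀ (m' : ℕ) (Y : Fin (2 * m') → Γ), ‖K m' Y‖ = ‖kernel 𝕜 V (2 * m') Y‖ := by
    intro m' Y
    rw [hK]
    dsimp only
    rw [show -V = (-1 : 𝕜) • V from (neg_one_smul 𝕜 V).symm, kernel_smul, norm_mul, norm_neg, norm_one, one_mul]
  have hNw : ∀ (m' : ℕ) (j : Fin (2 * m')) (w : Γ), ∑ Y ∈ univ.filter (fun Y : Fin (2 * m') → Γ => Y j = w), ‖K m' Y‖ * wt (univ.image Y) ≤ N m' := by
    intro m' j w
    simp only [hKnorm]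
    exact hN m' j w
  -- the unweighted hypotheses follow from the weighted ones (`wt ≥ 1`)
  have hN' : ∀ (m' : ℕ) (j : Fin (2 * m')) (w : Γ), ∑ Y ∈ univ.filter (fun Y : Fin (2 * m') → Γ => Y j = w), ‖K m' Y‖ ≤ N m' :=
    fun m' j w => (sum_norm_le_sum_norm_mul_wt hwt _ _).trans (hNw m' j w)
  have hrow' : ∀ X, ∑ Y, ‖C X Y‖ ≤ α := fun X => (sum_norm_le_sum_norm_mul_wt_pair hwt univ (fun Y => C X Y) fun Y => {X, Y}).trans (hrow X)
  have hcol' : ∀ Y, ∑ X, ‖C X Y‖ ≤ α := fun Y => (sum_norm_le_sum_norm_mul_wt_pair hwt univ (fun X => C X Y) fun X => {X, Y}).trans (hcol Y)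
  have hK0 : ∀ Y, K 0 Y = 0 := fun Y => by
    rw [hK]
    dsimp only
    rw [kernel_zero, map_neg, hV0, neg_zero]
  -- the cumulants and their bounds
  set κs : ℕ → evenPart 𝕜 Γ := fun n => cumulantOf (fun k => evenGaussConv 𝕜 C (X ^ k)) n with hκs
  have hκs_eq : ∀ n, κs n = cumulantOf (fun k => evenGaussConv 𝕜 C (vertexOf 𝕜 degs K ^ k)) n := fun n => by rw [hXv]
  have hbd : ∀ {n : ℕ}, 0 < n → ∀ {m : ℕ} (i : Fin m) (w : Γ),
      ∑ W ∈ univ.filter (fun W : Fin m → Γ => W i = w), wt (univ.image W) * ‖kernel 𝕜 ((κs n : evenPart 𝕜 Γ) : GrassmannAlgebra 𝕜 Γ) m W‖ ≤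
        (n ! : ℝ) * (ρ⁻¹ ^ m * (κ ^ 2 / α) * θ ^ n) := by
    intro n hn m i w
    have h := sum_wt_norm_kernel_cumulantOf_le_pow_of_gramBounded C hwt hκ hGB degs K N hN0 hNw hα hrow hcol hρ hn i w
    rw [← hκs_eq, hnVsum] at h
    refine h.trans (le_of_eq ?_)
    obtain ⟨n', rfl⟩ : ∃ n', n = n' + 1 := ⟨n - 1, by omega⟩
    rw [hθdef, hexpn, Nat.add_sub_cancel, div_pow, inv_pow, inv_pow]
    field_simp
    ring
  have hbd0 : ∀ {n : ℕ}, 0 < n → ‖constPart 𝕜 ((κs n : evenPart 𝕜 Γ) : GrassmannAlgebra 𝕜 Γ)‖ ≤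
      (n ! : ℝ) * ((Fintype.card Γ : ℝ) * (κ ^ 2 / α) * θ ^ n) := by
    intro n hn
    have h := norm_constPart_cumulantOf_le_pow_of_gramBounded C hκ hGB degs K hK0 N hN0 hN' hα hrow' hcol' hρ hn
    rw [← hκs_eq, hnVsum] at h
    refine h.trans (le_of_eq ?_)
    obtain ⟨n', rfl⟩ : ∃ n', n = n' + 1 := ⟨n - 1, by omega⟩
    rw [hθdef, hexpn, Nat.add_sub_cancel, div_pow, inv_pow]
    field_simp
    ring
  have hgeom : Summable fun n : ℕ => θ ^ n := summable_geometric_of_lt_one hθ0 hθ1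
  -- a single weighted term is at most the pinned weighted sum over its own fibre; `wt ≥ 1`
  have hsingle : ∀ {n m : ℕ} (i : Fin m) (W : Fin m → Γ), wt (univ.image W) * ‖kernel 𝕜 ((κs n : evenPart 𝕜 Γ) : GrassmannAlgebra 𝕜 Γ) m W‖ ≤
      ∑ W' ∈ univ.filter (fun W' : Fin m → Γ => W' i = W i), wt (univ.image W') * ‖kernel 𝕜 ((κs n : evenPart 𝕜 Γ) : GrassmannAlgebra 𝕜 Γ) m W'‖ :=
    fun i W => single_le_sum (f := fun W' => wt (univ.image W') * ‖kernel 𝕜 ((κs _ : evenPart 𝕜 Γ) : GrassmannAlgebra 𝕜 Γ) _ W'‖)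
      (fun W' _ => mul_nonneg (hwt.nonneg _) (norm_nonneg _)) (mem_filter.2 ⟨mem_univ _, rfl⟩)
  have hone : ∀ {n m : ℕ} (W : Fin m → Γ), ‖kernel 𝕜 ((κs n : evenPart 𝕜 Γ) : GrassmannAlgebra 𝕜 Γ) m W‖ ≤
      wt (univ.image W) * ‖kernel 𝕜 ((κs n : evenPart 𝕜 Γ) : GrassmannAlgebra 𝕜 Γ) m W‖ :=
    fun W => le_mul_of_one_le_left (norm_nonneg _) (hwt.one_le _)
  -- the kernel series converge absolutely (the hypothesis of the identification)
  have hsum : ∀ (m' : ℕ) (Y : Fin (2 * m') → Γ), Summable fun n : ℕ =>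
      ‖kernel 𝕜 ((κs n : evenPart 𝕜 Γ) : GrassmannAlgebra 𝕜 Γ) (2 * m') Y‖ / n ! := by
    intro m' Y
    rw [← summable_nat_add_iff 1]
    rcases m' with _ | m'
    · refine Summable.of_nonneg_of_le (fun n => by positivity) (fun n => ?_) (hgeom.mul_left ((Fintype.card Γ : ℝ) * (κ ^ 2 / α) * θ))
      have hk : kernel 𝕜 ((κs (n + 1) : evenPart 𝕜 Γ) : GrassmannAlgebra 𝕜 Γ) (2 * 0) Y =
          constPart 𝕜 ((κs (n + 1) : evenPart 𝕜 Γ) : GrassmannAlgebra 𝕜 Γ) := kernel_zero 𝕜 _ Y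
      rw [hk, div_le_iff₀ (by positivity)]
      refine (hbd0 (n := n + 1) n.succ_pos).trans (le_of_eq ?_)
      rw [pow_succ]
      ring
    · refine Summable.of_nonneg_of_le (fun n => by positivity) (fun n => ?_) (hgeom.mul_left (ρ⁻¹ ^ (2 * (m' + 1)) * (κ ^ 2 / α) * θ))
      rw [div_le_iff₀ (by positivity)]
      refine (((hone Y).trans (hsingle ⟨0, by omega⟩ Y)).trans (hbd (n := n + 1) n.succ_pos _ _)).trans (le_of_eq ?_)
      rw [pow_succ]
      ring
  -- the identification
  obtain ⟨hunit, hker⟩ := kernel_effAction_eq_neg_tsum 𝕜 Γ C V hV hV0 hsum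
  refine ⟨hunit, @fun m hm i w => ?_⟩
  set a : ℕ → (Fin m → Γ) → 𝕜 := fun n W => if n = 0 then 0 else
    ((n ! : 𝕜))⁻¹ * kernel 𝕜 ((κs n : evenPart 𝕜 Γ) : GrassmannAlgebra 𝕜 Γ) m W with ha
  have hanorm : ∀ n W, wt (univ.image W) * ‖a n W‖ =
      if n = 0 then 0 else (n ! : ℝ)⁻¹ * (wt (univ.image W) * ‖kernel 𝕜 ((κs n : evenPart 𝕜 Γ) : GrassmannAlgebra 𝕜 Γ) m W‖) := by
    intro n W
    rw [ha]
    dsimp only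
    split_ifs
    · rw [norm_zero, mul_zero]
    · rw [norm_mul, norm_inv, RCLike.norm_natCast]; ring
  -- every weighted term is bounded by the weighted pinned sum over its own fibre
  have haW : ∀ n W, wt (univ.image W) * ‖a n W‖ ≤ ρ⁻¹ ^ m * (κ ^ 2 / α) * θ ^ n := by
    intro n W
    rw [hanorm]
    split_ifs with hn
    · positivity
    · calc (n ! : ℝ)⁻¹ * (wt (univ.image W) * ‖kernel 𝕜 ((κs n : evenPart 𝕜 Γ) : GrassmannAlgebra 𝕜 Γ) m W‖)
          ≤ (n ! : ℝ)⁻¹ * ((n ! : ℝ) * (ρ⁻¹ ^ m * (κ ^ 2 / α) * θ ^ n)) :=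
            mul_le_mul_of_nonneg_left ((hsingle i W).trans (hbd (Nat.pos_of_ne_zero hn) i (W i))) (by positivity)
        _ = ρ⁻¹ ^ m * (κ ^ 2 / α) * θ ^ n := by field_simp
  have hsW : ∀ W, Summable fun n => wt (univ.image W) * ‖a n W‖ := fun W =>
    Summable.of_nonneg_of_le (fun n => mul_nonneg (hwt.nonneg _) (norm_nonneg _)) (fun n => haW n W) (hgeom.mul_left _)
  have hsWn : ∀ W, Summable fun n => ‖a n W‖ := fun W =>
    (hsW W).of_nonneg_of_le (fun n => norm_nonneg _) fun n => le_mul_of_one_le_left (norm_nonneg _) (hwt.one_le _)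
  have hsW' : ∀ W, Summable fun n => a n W := fun W => (hsWn W).of_norm
  -- the weighted pinned row sums of the terms
  have hrowbd : ∀ {n : ℕ}, 0 < n → ∑ W ∈ univ.filter (fun W : Fin m → Γ => W i = w), wt (univ.image W) * ‖a n W‖ ≤
      ρ⁻¹ ^ m * (κ ^ 2 / α) * θ ^ n := by
    intro n hn
    simp only [hanorm, if_neg hn.ne']
    rw [← mul_sum]
    calc (n ! : ℝ)⁻¹ * ∑ W ∈ univ.filter (fun W : Fin m → Γ => W i = w),
            wt (univ.image W) * ‖kernel 𝕜 ((κs n : evenPart 𝕜 Γ) : GrassmannAlgebra 𝕜 Γ) m W‖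
        ≤ (n ! : ℝ)⁻¹ * ((n ! : ℝ) * (ρ⁻¹ ^ m * (κ ^ 2 / α) * θ ^ n)) :=
          mul_le_mul_of_nonneg_left (hbd hn i w) (by positivity)
      _ = ρ⁻¹ ^ m * (κ ^ 2 / α) * θ ^ n := by field_simp
  -- splitting off the first `n₀` terms: `kernel (effAction) + Σ_{1 ≤ n < n₀} a n = -Σ' n, a (n + n₀)`
  have hsplit : ∀ W, kernel 𝕜 (effAction 𝕜 C V) m W + ∑ n ∈ Ico 1 n₀, ((n ! : 𝕜))⁻¹ *
      kernel 𝕜 ((κs n : evenPart 𝕜 Γ) : GrassmannAlgebra 𝕜 Γ) m W = -∑' n, a (n + n₀) W := by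
    intro W
    have hk : kernel 𝕜 (effAction 𝕜 C V) m W = -∑' n, a n W := hker hm W
    have hIco : ∑ n ∈ Ico 1 n₀, ((n ! : 𝕜))⁻¹ * kernel 𝕜 ((κs n : evenPart 𝕜 Γ) : GrassmannAlgebra 𝕜 Γ) m W =
        ∑ n ∈ range n₀, a n W := by
      rw [range_eq_Ico, sum_eq_sum_Ico_succ_bot hn₀]
      simp only [ha, if_true, zero_add]
      refine sum_congr rfl fun n hn => ?_
      rw [if_neg (by have := (mem_Ico.1 hn).1; omega)]
    rw [hk, hIco, ← (hsW' W).sum_add_tsum_nat_add n₀]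
    ring
  have hsWsn : ∀ W, Summable fun n => ‖a (n + n₀) W‖ := fun W =>
    (summable_nat_add_iff (f := fun n => ‖a n W‖) n₀).2 (hsWn W)
  have hsWs : ∀ W, Summable fun n => wt (univ.image W) * ‖a (n + n₀) W‖ := fun W =>
    (summable_nat_add_iff (f := fun n => wt (univ.image W) * ‖a n W‖) n₀).2 (hsW W)
  have hrow'' : ∀ n, ∑ W ∈ univ.filter (fun W : Fin m → Γ => W i = w), wt (univ.image W) * ‖a (n + n₀) W‖ ≤
      ρ⁻¹ ^ m * (κ ^ 2 / α) * θ ^ n₀ * θ ^ n := fun n =>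
    (hrowbd (n := n + n₀) (by omega)).trans (le_of_eq (by rw [pow_add]; ring))
  calc ∑ W ∈ univ.filter (fun W : Fin m → Γ => W i = w), wt (univ.image W) * ‖kernel 𝕜 (effAction 𝕜 C V) m W +
        ∑ n ∈ Ico 1 n₀, ((n ! : 𝕜))⁻¹ * kernel 𝕜 ((κs n : evenPart 𝕜 Γ) : GrassmannAlgebra 𝕜 Γ) m W‖
      = ∑ W ∈ univ.filter (fun W : Fin m → Γ => W i = w), wt (univ.image W) * ‖∑' n, a (n + n₀) W‖ :=
        sum_congr rfl fun W _ => by rw [hsplit W, norm_neg]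
    _ ≤ ∑ W ∈ univ.filter (fun W : Fin m → Γ => W i = w), ∑' n, wt (univ.image W) * ‖a (n + n₀) W‖ := by
        refine sum_le_sum fun W _ => ?_
        rw [tsum_mul_left]
        exact mul_le_mul_of_nonneg_left (norm_tsum_le_tsum_norm (hsWsn W)) (hwt.nonneg _)
    _ = ∑' n, ∑ W ∈ univ.filter (fun W : Fin m → Γ => W i = w), wt (univ.image W) * ‖a (n + n₀) W‖ :=
        (Summable.tsum_finsetSum fun W _ => hsWs W).symm
    _ ≤ ∑' n, ρ⁻¹ ^ m * (κ ^ 2 / α) * θ ^ n₀ * θ ^ n :=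
        Summable.tsum_le_tsum hrow'' (summable_sum fun W _ => hsWs W) (hgeom.mul_left _)
    _ = ρ⁻¹ ^ m * (κ ^ 2 / α) * θ ^ n₀ * (1 - θ)⁻¹ := by rw [tsum_mul_left, tsum_geometric_of_lt_one hθ0 hθ1]
    _ = ρ⁻¹ ^ m * (Real.exp 1 * nV) * θ ^ (n₀ - 1) / (1 - θ) := by
        obtain ⟨k, rfl⟩ : ∃ k, n₀ = k + 1 := ⟨n₀ - 1, by omega⟩
        have hκ2 : κ ^ 2 ≠ 0 := by positivity
        have hαne : α ≠ 0 := hα.ne'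
        rw [Nat.add_sub_cancel, div_eq_mul_inv _ (1 - θ)]
        congr 1
        rw [show θ ^ (k + 1) = θ ^ k * θ from pow_succ θ k, hθdef]
        field_simp

/-- (Twin of `sum_wt_norm_kernel_effAction_sub_gaussConv_le` under `IsGramBoundedR`.) **The non-linear part of the renormalisation-group map is second order, with decay** (`n₀ = 2`, weighted; Gawȩdzki–Kupiainen 1985,
§3; BGM 2006, (2.86)–(2.90)): with `θ = eα‖V‖_h/κ² < 1`, in every degree `m ≥ 1`, one output label pinned,
`Σ_{W : W_i = w} ‖kernel_m (effAction C V - e^{Δ_C} V) (W)‖ ≤ ρ^{-m} · e‖V‖_h · θ/(1 - θ)` — the first cumulant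
`𝓔ᵀ_C(-V; 1) = -e^{Δ_C} V` is the LINEAR part of `V ↦ effAction C V`, and what is left is bounded by the square of
`‖V‖_h`. [cite: BenfattoGiulianiMastropietro2006, (2.13)-(2.14) and (2.86)-(2.90)] -/
theorem sum_wt_norm_kernel_effAction_sub_gaussConv_le_of_gramBounded (hwt : IsTreeWeight wt) {κ : ℝ} (hκ : 0 < κ)
    (hGB : IsGramBoundedR C κ)
    (V : GrassmannAlgebra 𝕜 Γ) (hV : V ∈ evenPart 𝕜 Γ) (hV0 : constPart 𝕜 V = 0) (N : ℕ → ℝ) (hN0 : ∀ m', 0 ≤ N m')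
    (hN : ∀ m' (j : Fin (2 * m')) (w : Γ), ∑ Y ∈ univ.filter (fun Y : Fin (2 * m') → Γ => Y j = w),
      ‖kernel 𝕜 V (2 * m') Y‖ * wt (univ.image Y) ≤ N m')
    {α : ℝ} (hα : 0 < α) (hrow : ∀ X, ∑ Y, ‖C X Y‖ * wt {X, Y} ≤ α) (hcol : ∀ Y, ∑ X, ‖C X Y‖ * wt {X, Y} ≤ α) {ρ : ℝ} (hρ : 0 < ρ)
    (hθ : Real.exp 1 * α * normV Γ κ ρ N / κ ^ 2 < 1) :
    IsUnit (effPartitionFn 𝕜 C V) ∧ ∀ {m : ℕ}, 0 < m → ∀ (i : Fin m) (w : Γ),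
      ∑ W ∈ univ.filter (fun W : Fin m → Γ => W i = w), wt (univ.image W) * ‖kernel 𝕜 (effAction 𝕜 C V - gaussConv 𝕜 C V) m W‖ ≤
        ρ⁻¹ ^ m * (Real.exp 1 * normV Γ κ ρ N) *
          (Real.exp 1 * α * normV Γ κ ρ N / κ ^ 2) / (1 - Real.exp 1 * α * normV Γ κ ρ N / κ ^ 2) := by
  obtain ⟨hunit, hbd⟩ := sum_wt_norm_kernel_effAction_add_sum_cumulant_le_of_gramBounded C hwt hκ hGB V hV hV0 N hN0 hN hα
    hrow hcol hρ hθ (n₀ := 2) two_pos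
  refine ⟨hunit, @fun m hm i w => ?_⟩
  have h := hbd hm i w
  simp only [show (2 : ℕ) - 1 = 1 from rfl, pow_one] at h
  refine (le_of_eq (sum_congr rfl fun W _ => congrArg (fun z => wt (univ.image W) * ‖z‖) ?_)).trans h
  -- `Σ_{1 ≤ n < 2} (n!)⁻¹ kernel 𝓔ᵀ(-V; n) = kernel (e^{Δ_C}(-V))`
  have hI : Finset.Ico 1 2 = {1} := by decide
  rw [hI, sum_singleton, Nat.factorial_one, Nat.cast_one, inv_one, one_mul, cumulantOf_one]
  simp only [pow_one, coe_evenGaussConv, map_neg]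
  rw [sub_eq_add_neg, kernel_add]

/-- (Twin of `sum_wt_norm_kernel_effAction_sub_secondOrder_le` under `IsGramBoundedR`.) **Second-order perturbation theory with a weighted third-order remainder** (`n₀ = 3`, weighted;
`𝓔ᵀ_C(-V; 2) = e^{Δ_C}(V²) - (e^{Δ_C}V)²`): with `θ = eα‖V‖_h/κ² < 1`, in every degree `m ≥ 1`, one output label
pinned, `Σ_{W : W_i = w} ‖kernel_m (effAction C V - e^{Δ_C}V + ½(e^{Δ_C}(V²) - (e^{Δ_C}V)²)) (W)‖ ≤
ρ^{-m} · e‖V‖_h · θ²/(1 - θ)`. [cite: BenfattoGiulianiMastropietro2006, (2.13)-(2.14) and (2.86)-(2.90)] -/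
theorem sum_wt_norm_kernel_effAction_sub_secondOrder_le_of_gramBounded (hwt : IsTreeWeight wt) {κ : ℝ} (hκ : 0 < κ)
    (hGB : IsGramBoundedR C κ)
    (V : GrassmannAlgebra 𝕜 Γ) (hV : V ∈ evenPart 𝕜 Γ) (hV0 : constPart 𝕜 V = 0) (N : ℕ → ℝ) (hN0 : ∀ m', 0 ≤ N m')
    (hN : ∀ m' (j : Fin (2 * m')) (w : Γ), ∑ Y ∈ univ.filter (fun Y : Fin (2 * m') → Γ => Y j = w),
      ‖kernel 𝕜 V (2 * m') Y‖ * wt (univ.image Y) ≤ N m')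
    {α : ℝ} (hα : 0 < α) (hrow : ∀ X, ∑ Y, ‖C X Y‖ * wt {X, Y} ≤ α) (hcol : ∀ Y, ∑ X, ‖C X Y‖ * wt {X, Y} ≤ α) {ρ : ℝ} (hρ : 0 < ρ)
    (hθ : Real.exp 1 * α * normV Γ κ ρ N / κ ^ 2 < 1) :
    IsUnit (effPartitionFn 𝕜 C V) ∧ ∀ {m : ℕ}, 0 < m → ∀ (i : Fin m) (w : Γ),
      ∑ W ∈ univ.filter (fun W : Fin m → Γ => W i = w), wt (univ.image W) *
        ‖kernel 𝕜 (effAction 𝕜 C V - gaussConv 𝕜 C V +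
          (2 : 𝕜)⁻¹ • (gaussConv 𝕜 C (V * V) - gaussConv 𝕜 C V * gaussConv 𝕜 C V)) m W‖ ≤
        ρ⁻¹ ^ m * (Real.exp 1 * normV Γ κ ρ N) *
          (Real.exp 1 * α * normV Γ κ ρ N / κ ^ 2) ^ 2 / (1 - Real.exp 1 * α * normV Γ κ ρ N / κ ^ 2) := by
  obtain ⟨hunit, hbd⟩ := sum_wt_norm_kernel_effAction_add_sum_cumulant_le_of_gramBounded C hwt hκ hGB V hV hV0 N hN0 hN hα
    hrow hcol hρ hθ (n₀ := 3) three_pos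
  refine ⟨hunit, @fun m hm i w => ?_⟩
  have h := hbd hm i w
  simp only [show (3 : ℕ) - 1 = 2 from rfl] at h
  refine (le_of_eq (sum_congr rfl fun W _ => congrArg (fun z => wt (univ.image W) * ‖z‖) ?_)).trans h
  have hμ0 : (fun k => evenGaussConv 𝕜 C ((⟨-V, neg_mem hV⟩ : evenPart 𝕜 Γ) ^ k)) 0 = 1 :=
    Subtype.ext (by simp only [pow_zero, coe_evenGaussConv, OneMemClass.coe_one, gaussConv_one])
  -- `Σ_{1 ≤ n < 3} (n!)⁻¹ kernel 𝓔ᵀ(-V; n) = kernel (e^{Δ_C}(-V) + ½ (e^{Δ_C}(V²) - (e^{Δ_C}(-V))²))`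
  have hI : Finset.Ico 1 3 = {1, 2} := by decide
  rw [hI, sum_pair (by norm_num), Nat.factorial_one, Nat.cast_one, inv_one, one_mul, cumulantOf_one,
    cumulantOf_two _ hμ0, Nat.factorial_two]
  simp only [pow_one, coe_evenGaussConv, AddSubgroupClass.coe_sub, MulMemClass.coe_mul, sq, map_neg, neg_mul_neg]
  rw [sub_eq_add_neg, kernel_add, kernel_add, kernel_smul, add_assoc]
  congr 3

end Literature.MathematicalPhysics.QuantumLattice
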